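/-
Copyright (c) 2026 the pub-hodgecm-mathlib formalisation cell (harness21).  Prover seat hodgecm-mathlib-K2E1-p10 (g2), Track B ∕ K2-LIT (build stream 29), h413 = `stmt-HodgeConjecture-24833`,
route of record `HCCMUnconditional`, ROADCARD «5Res ENDGAME BY FAMILIES» §2 C7; dealer K2E1-plan (g7) — THE C7 HEAD WITH THE CUSPIDAL DATUM AND THE `L²`-BRICK DISCHARGED: only F3d-α
(K2E1-p12's `K2E1NormOneTorusFamilyActionU2`∕`…ApproxU2`) remains hypothesis-first.
-/
import Summits.HodgeConjecture.HodgeConjecture.Theorems.K2E1PseudoEisensteinFamilyDecompositionU2      -- ★ THE C7 HEAD (this seat, p860399)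
import Summits.HodgeConjecture.HodgeConjecture.Theorems.K2E1CuspidalDensityQuasiSplitBridgeCMTwo      -- ★ the world bridge (this seat, p860429): `(𝔓, h𝔓, W, hE)` in the quasiSplit world
import Summits.HodgeConjecture.HodgeConjecture.Theorems.K2E1EisensteinNiceClassCMTwo                  -- ★ F3d-δ (K2E1-p15, p860388): `memLp_quotFun_eisensteinSeriesU_of_nice`
import HarnessLib

/-!
# h413 ∕ Track B «K2-LIT», ROADCARD «5Res BY FAMILIES» §2 C7 — `K2E1PseudoEisensteinFamilyDecompositionU2OfDelta`: **`(L²_cusp)ᗮ ∩ L²(X)^{K′} ⊆ closure ⨆_χ span{[quotFun (E (f(H)·φ))]}`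
# for the CM pair with the cuspidal datum (★ bridge p860429) and the `L²`-brick `hδ` (★ F3d-δ p860388) DISCHARGED — modulo the single remaining brick `hα` (F3d-α)**

Cell `pub/hodgecm-mathlib`, crux h413 = `stmt-HodgeConjecture-24833`, route of record `HCCMUnconditional`; dealer K2E1-plan (g7).  THEOREMS ONLY; lane `--supports stmt-HodgeConjecture-24833
--as helper` (count-neutral).  Closes no socket.  ★ HEAD `orthogonal_inf_invariants_le_topologicalClosure_iSup_family` with `W := (quasiSplit …).cuspidalSubspace μ 𝔓` for the Borel
parabolic data `𝔓` of ★ `exists_parabolicData_orthogonal_eq_quasiSplit_two` (`hE` = ★ f1's density transported), and `hδ :=` ★ `memLp_quotFun_eisensteinSeriesU_of_nice L μ 2`.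

* **`cuspidal_orthogonal_inf_invariants_le_topologicalClosure_iSup_family`** — the C7 statement of ROADCARD §2 modulo `hα` only.

HONEST LABEL: HC_CM is proved only modulo the 7 printed citations (2 remaining named inputs: hLiu418 = `stmt-HodgeConjecture-24832`, h413 = `stmt-HodgeConjecture-24833`) until rung 0
closes; this file asserts no named fact and closes no socket.
References: [MoeglinWaldspurger1995] C. Mœglin, J.-L. Waldspurger, *Spectral Decomposition and Eisenstein Series*, II.1.1–II.1.4, II.2.4; [BernsteinLapid2019] J. Bernstein, E. Lapid, *On the
meromorphic continuation of Eisenstein series*, §4.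
-/

set_option autoImplicit false
set_option linter.dupNamespace false  -- the mandated namespace repeats the summit's segment (`HodgeConjecture.HodgeConjecture`)

noncomputable section

open MeasureTheory Measure Set Filter Topology NumberField
open Literature.MeasureTheory.Group Literature.NumberTheory.Automorphic Literature.NumberTheory.Automorphic.UnitaryGroup Literature.NumberTheory.GaloisRepresentations AdelicGroupData ContRepresentation
open Summit.HodgeConjecture.HodgeConjecture.Cruxes.H413.K2E1BorelEisensteinU
open Summit.HodgeConjecture.HodgeConjecture.Cruxes.H413.K2E1CharacterEisensteinU2Defs
open Summit.HodgeConjecture.HodgeConjecture.Cruxes.H413.K2E1ChiSectionSpaceU2Defs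
open Summit.HodgeConjecture.HodgeConjecture.Cruxes.H413.K2E1PseudoEisensteinFamilyDecompositionU2 (orthogonal_inf_invariants_le_topologicalClosure_iSup_family)
open Summit.HodgeConjecture.HodgeConjecture.Cruxes.H413.K2E1CuspidalDensityQuasiSplitBridgeCMTwo (exists_parabolicData_orthogonal_eq_quasiSplit_two)
open Summit.HodgeConjecture.HodgeConjecture.Cruxes.H413.K2E1EisensteinNiceClassCMTwo (memLp_quotFun_eisensteinSeriesU_of_nice)
open scoped ENNReal NNReal

namespace Summit.HodgeConjecture.HodgeConjecture.Cruxes.H413.K2E1PseudoEisensteinFamilyDecompositionU2OfDelta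

variable (L : Type) [Field L] [NumberField L] [IsCMField L]
  [MeasurableSpace (quasiSplit (↥(maximalRealSubfield L)) L (IsCMField.complexConj L) 2).Adelic] [BorelSpace (quasiSplit (↥(maximalRealSubfield L)) L (IsCMField.complexConj L) 2).Adelic]
  (μ : Measure (quasiSplit (↥(maximalRealSubfield L)) L (IsCMField.complexConj L) 2).automorphicQuotient) [(quasiSplit (↥(maximalRealSubfield L)) L (IsCMField.complexConj L) 2).IsAutomorphicMeasure μ]

/-- **C7 MODULO F3d-α: `(L²_cusp)ᗮ ∩ L²(X)^{K′} ⊆ closure ⨆_χ span { [quotFun (E (f(H)·φ))] : f ∈ C_c((0,∞)), φ ∈ chiSectionSpace χ K′ 1 }`** for the CM pair in the `quasiSplit` world, for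
the Borel parabolic data `𝔓` of the bridge (every radical `= N(𝔸)`), any automorphic `μ`, Haar `ν`, open compact `K′` with `H` right-`K′`-invariant, finitely many `(B(𝔸),K′)`-double
cosets and a bi-invariant inversion-invariant probability `μK` on `K′` — ★ HEAD with `(𝔓, h𝔓, W, hE)` from ★ `exists_parabolicData_orthogonal_eq_quasiSplit_two` and `hδ` from ★ F3d-δ.
[cite: MoeglinWaldspurger1995, II.1.1–II.1.4, II.2.4] [cite: BernsteinLapid2019, §4] -/
theorem cuspidal_orthogonal_inf_invariants_le_topologicalClosure_iSup_family (hc : IsCMField.complexConj L * IsCMField.complexConj L = 1)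
    (ν : Measure (quasiSplit (↥(maximalRealSubfield L)) L (IsCMField.complexConj L) 2).Adelic) [ν.IsHaarMeasure]
    (K' : Subgroup (quasiSplit (↥(maximalRealSubfield L)) L (IsCMField.complexConj L) 2).Adelic) (hK'o : IsOpen (K' : Set (quasiSplit (↥(maximalRealSubfield L)) L (IsCMField.complexConj L) 2).Adelic))
    (hK'c : IsCompact (K' : Set (quasiSplit (↥(maximalRealSubfield L)) L (IsCMField.complexConj L) 2).Adelic))
    (hHK' : ∀ (g k : (quasiSplit (↥(maximalRealSubfield L)) L (IsCMField.complexConj L) 2).Adelic), k ∈ K' → borelHeight (g * k) = borelHeight g)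
    (hBK : ∃ W : Finset (quasiSplit (↥(maximalRealSubfield L)) L (IsCMField.complexConj L) 2).Adelic, ∀ g, ∃ β ∈ borelAdelic (↥(maximalRealSubfield L)) L (IsCMField.complexConj L) 2, ∃ w ∈ W, ∃ k ∈ K', g = β * w * k)
    (μK : Measure ↥K') [IsProbabilityMeasure μK] [μK.IsMulLeftInvariant] [μK.IsMulRightInvariant] [μK.IsInvInvariant]
    (hα : ∀ (ψ : (quasiSplit (↥(maximalRealSubfield L)) L (IsCMField.complexConj L) 2).Adelic → ℂ), Continuous ψ →
      (∀ (u : adelicUnipotent (↥(maximalRealSubfield L)) L (IsCMField.complexConj L) 2) (g : (quasiSplit (↥(maximalRealSubfield L)) L (IsCMField.complexConj L) 2).Adelic),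
        ψ ((u : (quasiSplit (↥(maximalRealSubfield L)) L (IsCMField.complexConj L) 2).Adelic) * g) = ψ g) →
      (∀ b ∈ arithmeticBorel (↥(maximalRealSubfield L)) L (IsCMField.complexConj L) 2, ∀ g, ψ ((b : (quasiSplit (↥(maximalRealSubfield L)) L (IsCMField.complexConj L) 2).Adelic) * g) = ψ g) →
      (∀ (g : (quasiSplit (↥(maximalRealSubfield L)) L (IsCMField.complexConj L) 2).Adelic) (k : K'), ψ (g * (k : (quasiSplit (↥(maximalRealSubfield L)) L (IsCMField.complexConj L) 2).Adelic)) = ψ g) →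
      ∀ {a b : ℝ≥0}, 0 < a → (∀ g, ψ g ≠ 0 → a ≤ borelHeight g ∧ borelHeight g ≤ b) → ∀ ε : ℝ, 0 < ε →
        ∃ (s : Finset (HeckeCharacter L)) (coef : HeckeCharacter L → ℂ) (P : HeckeCharacter L → (quasiSplit (↥(maximalRealSubfield L)) L (IsCMField.complexConj L) 2).Adelic → ℂ),
          (∀ χ ∈ s, (∀ r : ℝ≥0ˣ, χ (posRealIdele L r) = 1) ∧ Continuous (P χ) ∧
            (∀ (g : (quasiSplit (↥(maximalRealSubfield L)) L (IsCMField.complexConj L) 2).Adelic) (k : K'), P χ (g * (k : (quasiSplit (↥(maximalRealSubfield L)) L (IsCMField.complexConj L) 2).Adelic)) = P χ g) ∧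
            (∀ b ∈ arithmeticBorel (↥(maximalRealSubfield L)) L (IsCMField.complexConj L) 2, ∀ g, P χ ((b : (quasiSplit (↥(maximalRealSubfield L)) L (IsCMField.complexConj L) 2).Adelic) * g) = P χ g) ∧
            (∀ (b : (quasiSplit (↥(maximalRealSubfield L)) L (IsCMField.complexConj L) 2).Adelic) (hb : b ∈ borelAdelic (↥(maximalRealSubfield L)) L (IsCMField.complexConj L) 2),
              IdeleClassGroup.ideleNorm L (firstEntryUnit hb) = 1 → ∀ g, P χ (b * g) = ((χ (firstEntryUnit hb) : ℂˣ) : ℂ) * P χ g) ∧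
            (∀ g, P χ g ≠ 0 → a ≤ borelHeight g ∧ borelHeight g ≤ b) ∧ (∃ M : ℝ, ∀ g, ‖P χ g‖ ≤ M)) ∧
          ∀ g, ‖ψ g - ∑ χ ∈ s, coef χ * P χ g‖ ≤ ε) :
    ∃ 𝔓 : (quasiSplit (↥(maximalRealSubfield L)) L (IsCMField.complexConj L) 2).ParabolicUnipotentData,
      (∀ i : 𝔓.ι, 𝔓.radical i = adelicUnipotent (↥(maximalRealSubfield L)) L (IsCMField.complexConj L) 2) ∧
      ((quasiSplit (↥(maximalRealSubfield L)) L (IsCMField.complexConj L) 2).cuspidalSubspace μ 𝔓).toSubmoduleᗮ ⊓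
          (((quasiSplit (↥(maximalRealSubfield L)) L (IsCMField.complexConj L) 2).rightRegular μ).restrict K'.subtype).invariants ≤
      (⨆ χ : HeckeCharacter L, Submodule.span ℂ {v : (quasiSplit (↥(maximalRealSubfield L)) L (IsCMField.complexConj L) 2).L2 μ |
        ∃ (f : ℝ → ℂ) (_ : Continuous f) (_ : HasCompactSupport f) (_ : tsupport f ⊆ Ioi 0)
          (φ : (quasiSplit (↥(maximalRealSubfield L)) L (IsCMField.complexConj L) 2).Adelic → ℂ) (_ : φ ∈ chiSectionSpace χ K' 1) (_ : Continuous φ)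
          (hv : MemLp ((quasiSplit (↥(maximalRealSubfield L)) L (IsCMField.complexConj L) 2).quotFun (eisensteinSeriesU (fun g => f (borelHeight g) * φ g))) 2 μ), v = hv.toLp _}).topologicalClosure := by
  obtain ⟨𝔓, h𝔓, hE⟩ := exists_parabolicData_orthogonal_eq_quasiSplit_two L
  refine ⟨𝔓, h𝔓, ?_⟩
  exact orthogonal_inf_invariants_le_topologicalClosure_iSup_family μ hc ν 𝔓 h𝔓 K' hK'o hK'c hHK' hBK μK
    ((quasiSplit (↥(maximalRealSubfield L)) L (IsCMField.complexConj L) 2).cuspidalSubspace μ 𝔓) rfl (hE inferInstance μ inferInstance) hα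
    (fun u huc huB hM _ _ ha hband => by
      obtain ⟨M, huM⟩ := hM
      exact memLp_quotFun_eisensteinSeriesU_of_nice L μ 2 huc huB huM ha hband)

end Summit.HodgeConjecture.HodgeConjecture.Cruxes.H413.K2E1PseudoEisensteinFamilyDecompositionU2OfDelta

end
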